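import Literature.MathematicalPhysics.QuantumLattice.GrassmannWeightedCumulantBiGradedDB
import Literature.MathematicalPhysics.QuantumLattice.GrassmannWeightedEffectiveActionBound
import Literature.MathematicalPhysics.QuantumLattice.GrassmannEffectiveActionBiGradedDB
import HarnessLib

/-!
# The decay-weighted BI-GRADED single-scale step for DETERMINANT-BOUNDED covariances:
# `Σ_{W : W_i = w} wt(W) ‖kernel_{2p} (effAction C V)(W)‖ ≤ ρ^{-2p} · e f₂ · θ₂^{p-2}/(1-θ)^p`

Topic `MathematicalPhysics/QuantumLattice`; the WEIGHTED form of `GrassmannEffectiveActionBiGradedDB` (`sum_norm_kernel_effAction_le_biquartic_of_gramBounded`)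
and the bi-graded, determinant-bounded form of `GrassmannWeightedEffectiveActionBound` (`sum_wt_norm_kernel_effAction_le`).  For a tree weight
`wt` on label sets (`SubmultiplicativeTreeWeight.lean`, e.g. `1 + diam`, whose pair value dominates the first position-space moment), an even
interaction `V` without constant part whose kernels live in degrees `≤ 4` and have `wt`-weighted pinned `L¹` norms `N(m')`, a covariance
replica-stably Gram-bounded with constant `κ` (`IsGramBoundedR` — Pedra–Salmhofer determinant-bounded chronological propagators included)
whose `wt`-pair-weighted row and column sums are at most `α`, an output weight `ρ > 0` and `θ = eα‖V‖_{h,wt}/κ² < 1`: the normalised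
partition function is a unit and for `p ≥ 2`, one output label pinned and the others summed against the weight of the output label set,

  `Σ_{W : W_i = w} wt(W) ‖kernel_{2p} (effAction C V)(W)‖ ≤ ρ^{-2p} · e f₂ · θ₂^{p-2} / (1-θ)^p`,

`f₂ = (e²(κ+ρ))⁴ N(2)`, `θ₂ = eαf₂/κ²` (**`sum_wt_norm_kernel_effAction_le_biquartic_of_gramBounded`**): the degree-`2p` kernels inherit
the decay of the inputs and of the tree lines (Benfatto–Giuliani–Mastropietro 2006, §3 (3.2)–(3.8)) and are of order `p - 1` in the QUARTIC
coupling whatever the weighted size of the quadratic part ((2.13)–(2.14): quadratic vertices do not raise the number of external legs).  The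
proof is that of the unweighted bi-graded file with the weighted order-`n` bounds (`sum_wt_norm_kernel_cumulantOf_le_pow_of_gramBounded`,
`sum_wt_norm_kernel_cumulantOf_le_biquartic_of_gramBounded`) in place of the unweighted ones; the vacuum bound (a unit) needs no weight
(`wt ≥ 1`: the unweighted hypotheses follow).  Used by the scale-`0` first-moment bound (E4)₀ of the K3 engine of the cell gate-hubbard-kl.

Everything is proved; no definition, no named fact.

## Sources

G. Benfatto, A. Giuliani, V. Mastropietro, Ann. Henri Poincaré 7 (2006) 809–898, (2.13)–(2.14), (2.77)–(2.80), §3 (3.2)–(3.8)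
[`BenfattoGiulianiMastropietro2006`]; W. de Siqueira Pedra, M. Salmhofer, Comm. Math. Phys. 282 (2008) 797–818, Thm 1.3, Thm 2.4
[`PedraSalmhofer2008`]; K. Gawȩdzki, A. Kupiainen, Comm. Math. Phys. 102 (1985) 1–30, §3 [`GawedzkiKupiainen1985GrossNeveu`].
-/

noncomputable section

namespace Literature.MathematicalPhysics.QuantumLattice

open GrassmannAlgebra Finset Literature.Probability.LatticeModels Literature.Probability.LatticeModels.BattleFederbush
open scoped InnerProductSpace Nat

universe u

variable {𝕜 : Type*} [RCLike 𝕜] {Γ : Type u} [Fintype Γ] [DecidableEq Γ] {wt : Finset Γ → ℝ} (C : Matrix Γ Γ 𝕜)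

/-- **The decay-weighted bi-graded single-scale step, determinant-bounded covariance** (BGM 2006, (2.13)–(2.14) with (2.77)–(2.80) and
§3 (3.2)–(3.8); Gawȩdzki–Kupiainen 1985, §3): tree weight `wt`, covariance replica-stably Gram-bounded with constant `κ`, `wt`-weighted
row/column sums `≤ α`, output weight `ρ`, interaction `V` (even, no constant part) with `wt`-weighted pinned norms `N(m')` VANISHING for
`m' > 2`, `θ = eα‖V‖_{h,wt}/κ² < 1`; then the normalised partition function is a unit and for `p ≥ 2`, every pinned label,
`Σ_{W : W_i = w} wt(W) ‖kernel_{2p} (effAction C V)(W)‖ ≤ ρ^{-2p} · e f₂ · θ₂^{p-2}/(1-θ)^p` with `f₂ = (e²(κ+ρ))⁴N(2)`, `θ₂ = eαf₂/κ²`.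
[cite: BenfattoGiulianiMastropietro2006, (2.13)-(2.14), (2.77)-(2.80) and §3 (3.2)-(3.8)] -/
theorem sum_wt_norm_kernel_effAction_le_biquartic_of_gramBounded (hwt : IsTreeWeight wt) {κ : ℝ} (hκ : 0 < κ)
    (hGB : IsGramBoundedR C κ)
    (V : GrassmannAlgebra 𝕜 Γ) (hV : V ∈ evenPart 𝕜 Γ) (hV0 : constPart 𝕜 V = 0) (N : ℕ → ℝ) (hN0 : ∀ m', 0 ≤ N m')
    (hN : ∀ m' (j : Fin (2 * m')) (w : Γ), ∑ Y ∈ univ.filter (fun Y : Fin (2 * m') → Γ => Y j = w),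
      ‖kernel 𝕜 V (2 * m') Y‖ * wt (univ.image Y) ≤ N m')
    (hN2 : ∀ m', 2 < m' → N m' = 0)
    {α : ℝ} (hα : 0 < α) (hrow : ∀ X, ∑ Y, ‖C X Y‖ * wt {X, Y} ≤ α) (hcol : ∀ Y, ∑ X, ‖C X Y‖ * wt {X, Y} ≤ α) {ρ : ℝ} (hρ : 0 < ρ)
    (hθ : Real.exp 1 * α * normV Γ κ ρ N / κ ^ 2 < 1) {p : ℕ} (hp : 2 ≤ p) :
    IsUnit (effPartitionFn 𝕜 C V) ∧ ∀ (i : Fin (2 * p)) (w : Γ),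
      ∑ W ∈ univ.filter (fun W : Fin (2 * p) → Γ => W i = w), wt (univ.image W) * ‖kernel 𝕜 (effAction 𝕜 C V) (2 * p) W‖ ≤
        ρ⁻¹ ^ (2 * p) * (Real.exp 1 * ((Real.exp 2 * (κ + ρ)) ^ (2 * 2) * N 2)) *
          (Real.exp 1 * α * ((Real.exp 2 * (κ + ρ)) ^ (2 * 2) * N 2) / κ ^ 2) ^ (p - 2) /
            (1 - Real.exp 1 * α * normV Γ κ ρ N / κ ^ 2) ^ p := by
  -- notation
  set X : evenPart 𝕜 Γ := ⟨-V, neg_mem hV⟩ with hX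
  set degs : Finset ℕ := range (Fintype.card Γ / 2 + 1) with hdegs
  set K : (m' : ℕ) → (Fin (2 * m') → Γ) → 𝕜 := fun m' => kernel 𝕜 (-V) (2 * m') with hK
  set nV : ℝ := normV Γ κ ρ N with hnV
  set θ : ℝ := Real.exp 1 * α * nV / κ ^ 2 with hθdef
  have hnV0 : 0 ≤ nV := normV_nonneg hκ.le hρ.le hN0
  have hθ0 : 0 ≤ θ := by positivity
  have hθ1 : θ < 1 := hθ
  have hnVsum : ∑ m' ∈ degs, (Real.exp 2 * (κ + ρ)) ^ (2 * m') * N m' = nV := rfl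
  have hexpn : ∀ k : ℕ, Real.exp k = Real.exp 1 ^ k := fun k => by rw [← Real.exp_nat_mul, mul_one]
  -- `-V` as the `vertexOf` of its kernels
  have hXv : vertexOf 𝕜 degs K = X := Subtype.ext (coe_vertexOf_kernel_eq 𝕜 X)
  have hKnorm : ∀ (m' : ℕ) (Y : Fin (2 * m') → Γ), ‖K m' Y‖ = ‖kernel 𝕜 V (2 * m') Y‖ := by
    intro m' Y
    rw [hK]
    dsimp only
    rw [show -V = (-1 : 𝕜) • V from (neg_one_smul 𝕜 V).symm, kernel_smul, norm_mul, norm_neg, norm_one, one_mul]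
  have hNw : ∀ (m' : ℕ) (j : Fin (2 * m')) (w : Γ), ∑ Y ∈ univ.filter (fun Y : Fin (2 * m') → Γ => Y j = w), ‖K m' Y‖ * wt (univ.image Y) ≤ N m' := by
    intro m' j w
    simp only [hKnorm]
    exact hN m' j w
  -- the unweighted hypotheses follow from the weighted ones (`wt ≥ 1`)
  have hN' : ∀ (m' : ℕ) (j : Fin (2 * m')) (w : Γ), ∑ Y ∈ univ.filter (fun Y : Fin (2 * m') → Γ => Y j = w), ‖K m' Y‖ ≤ N m' :=
    fun m' j w => (sum_norm_le_sum_norm_mul_wt hwt _ _).trans (hNw m' j w)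
  have hrow' : ∀ X, ∑ Y, ‖C X Y‖ ≤ α := fun X => (sum_norm_le_sum_norm_mul_wt_pair hwt univ (fun Y => C X Y) fun Y => {X, Y}).trans (hrow X)
  have hcol' : ∀ Y, ∑ X, ‖C X Y‖ ≤ α := fun Y => (sum_norm_le_sum_norm_mul_wt_pair hwt univ (fun X => C X Y) fun X => {X, Y}).trans (hcol Y)
  have hK0 : ∀ Y, K 0 Y = 0 := fun Y => by
    rw [hK]
    dsimp only
    rw [kernel_zero, map_neg, hV0, neg_zero]
  -- the cumulants and their bounds
  set κs : ℕ → evenPart 𝕜 Γ := fun n => cumulantOf (fun k => evenGaussConv 𝕜 C (X ^ k)) n with hκs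
  have hκs_eq : ∀ n, κs n = cumulantOf (fun k => evenGaussConv 𝕜 C (vertexOf 𝕜 degs K ^ k)) n := fun n => by rw [hXv]
  have hbd : ∀ {n : ℕ}, 0 < n → ∀ {m : ℕ} (i : Fin m) (w : Γ),
      ∑ W ∈ univ.filter (fun W : Fin m → Γ => W i = w), wt (univ.image W) * ‖kernel 𝕜 ((κs n : evenPart 𝕜 Γ) : GrassmannAlgebra 𝕜 Γ) m W‖ ≤
        (n ! : ℝ) * (ρ⁻¹ ^ m * (κ ^ 2 / α) * θ ^ n) := by
    intro n hn m i w
    have h := sum_wt_norm_kernel_cumulantOf_le_pow_of_gramBounded C hwt hκ hGB degs K N hN0 hNw hα hrow hcol hρ hn i w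
    rw [← hκs_eq, hnVsum] at h
    refine h.trans (le_of_eq ?_)
    obtain ⟨n', rfl⟩ : ∃ n', n = n' + 1 := ⟨n - 1, by omega⟩
    rw [hθdef, hexpn, Nat.add_sub_cancel, div_pow, inv_pow, inv_pow]
    field_simp
    ring
  -- a single weighted term is at most the pinned weighted sum over its own fibre
  have hsingle : ∀ {n m : ℕ} (i : Fin m) (W : Fin m → Γ), wt (univ.image W) * ‖kernel 𝕜 ((κs n : evenPart 𝕜 Γ) : GrassmannAlgebra 𝕜 Γ) m W‖ ≤
      ∑ W' ∈ univ.filter (fun W' : Fin m → Γ => W' i = W i), wt (univ.image W') * ‖kernel 𝕜 ((κs n : evenPart 𝕜 Γ) : GrassmannAlgebra 𝕜 Γ) m W'‖ :=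
    fun i W => single_le_sum (f := fun W' => wt (univ.image W') * ‖kernel 𝕜 ((κs _ : evenPart 𝕜 Γ) : GrassmannAlgebra 𝕜 Γ) _ W'‖)
      (fun W' _ => mul_nonneg (hwt.nonneg _) (norm_nonneg _)) (mem_filter.2 ⟨mem_univ _, rfl⟩)
  have hone : ∀ {n m : ℕ} (W : Fin m → Γ), ‖kernel 𝕜 ((κs n : evenPart 𝕜 Γ) : GrassmannAlgebra 𝕜 Γ) m W‖ ≤
      wt (univ.image W) * ‖kernel 𝕜 ((κs n : evenPart 𝕜 Γ) : GrassmannAlgebra 𝕜 Γ) m W‖ :=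
    fun W => le_mul_of_one_le_left (norm_nonneg _) (hwt.one_le _)
  have hbd0 : ∀ {n : ℕ}, 0 < n → ‖constPart 𝕜 ((κs n : evenPart 𝕜 Γ) : GrassmannAlgebra 𝕜 Γ)‖ ≤
      (n ! : ℝ) * ((Fintype.card Γ : ℝ) * (κ ^ 2 / α) * θ ^ n) := by
    intro n hn
    have h := norm_constPart_cumulantOf_le_pow_of_gramBounded C hκ hGB degs K hK0 N hN0 hN' hα hrow' hcol' hρ hn
    rw [← hκs_eq, hnVsum] at h
    refine h.trans (le_of_eq ?_)
    obtain ⟨n', rfl⟩ : ∃ n', n = n' + 1 := ⟨n - 1, by omega⟩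
    rw [hθdef, hexpn, Nat.add_sub_cancel, div_pow, inv_pow]
    field_simp
    ring
  have hgeom : Summable fun n : ℕ => θ ^ n := summable_geometric_of_lt_one hθ0 hθ1
  -- the kernel series converge absolutely (the hypothesis of the identification)
  have hsum : ∀ (m' : ℕ) (Y : Fin (2 * m') → Γ), Summable fun n : ℕ =>
      ‖kernel 𝕜 ((κs n : evenPart 𝕜 Γ) : GrassmannAlgebra 𝕜 Γ) (2 * m') Y‖ / n ! := by
    intro m' Y
    rw [← summable_nat_add_iff 1]
    rcases m' with _ | m'
    · refine Summable.of_nonneg_of_le (fun n => by positivity) (fun n => ?_) (hgeom.mul_left ((Fintype.card Γ : ℝ) * (κ ^ 2 / α) * θ))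
      have hk : kernel 𝕜 ((κs (n + 1) : evenPart 𝕜 Γ) : GrassmannAlgebra 𝕜 Γ) (2 * 0) Y =
          constPart 𝕜 ((κs (n + 1) : evenPart 𝕜 Γ) : GrassmannAlgebra 𝕜 Γ) := kernel_zero 𝕜 _ Y
      rw [hk, div_le_iff₀ (by positivity)]
      refine (hbd0 (n := n + 1) n.succ_pos).trans (le_of_eq ?_)
      rw [pow_succ]
      ring
    · refine Summable.of_nonneg_of_le (fun n => by positivity) (fun n => ?_) (hgeom.mul_left (ρ⁻¹ ^ (2 * (m' + 1)) * (κ ^ 2 / α) * θ))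
      rw [div_le_iff₀ (by positivity)]
      refine (((hone Y).trans (hsingle ⟨0, by omega⟩ Y)).trans (hbd (n := n + 1) n.succ_pos _ _)).trans (le_of_eq ?_)
      rw [pow_succ]
      ring
  -- the identification
  obtain ⟨hunit, hker⟩ := kernel_effAction_eq_neg_tsum 𝕜 Γ C V hV hV0 hsum
  refine ⟨hunit, fun i w => ?_⟩
  have hm : 0 < 2 * p := by omega
  set a : ℕ → (Fin (2 * p) → Γ) → 𝕜 := fun n W => if n = 0 then 0 else
    ((n ! : 𝕜))⁻¹ * kernel 𝕜 ((κs n : evenPart 𝕜 Γ) : GrassmannAlgebra 𝕜 Γ) (2 * p) W with ha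
  have hanorm : ∀ n W, wt (univ.image W) * ‖a n W‖ =
      if n = 0 then 0 else (n ! : ℝ)⁻¹ * (wt (univ.image W) * ‖kernel 𝕜 ((κs n : evenPart 𝕜 Γ) : GrassmannAlgebra 𝕜 Γ) (2 * p) W‖) := by
    intro n W
    rw [ha]
    dsimp only
    split_ifs
    · rw [norm_zero, mul_zero]
    · rw [norm_mul, norm_inv, RCLike.norm_natCast]; ring
  -- every weighted term is bounded by the weighted pinned sum over its own fibre
  have haW : ∀ n W, wt (univ.image W) * ‖a n W‖ ≤ ρ⁻¹ ^ (2 * p) * (κ ^ 2 / α) * θ ^ n := by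
    intro n W
    rw [hanorm]
    split_ifs with hn
    · positivity
    · calc (n ! : ℝ)⁻¹ * (wt (univ.image W) * ‖kernel 𝕜 ((κs n : evenPart 𝕜 Γ) : GrassmannAlgebra 𝕜 Γ) (2 * p) W‖)
          ≤ (n ! : ℝ)⁻¹ * ((n ! : ℝ) * (ρ⁻¹ ^ (2 * p) * (κ ^ 2 / α) * θ ^ n)) :=
            mul_le_mul_of_nonneg_left ((hsingle i W).trans (hbd (Nat.pos_of_ne_zero hn) i (W i))) (by positivity)
        _ = ρ⁻¹ ^ (2 * p) * (κ ^ 2 / α) * θ ^ n := by field_simp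
  have hsW : ∀ W, Summable fun n => wt (univ.image W) * ‖a n W‖ := fun W =>
    Summable.of_nonneg_of_le (fun n => mul_nonneg (hwt.nonneg _) (norm_nonneg _)) (fun n => haW n W) (hgeom.mul_left _)
  have hsW'' : ∀ W, Summable fun n => ‖a n W‖ := fun W =>
    (hsW W).of_nonneg_of_le (fun n => norm_nonneg _) fun n => le_mul_of_one_le_left (norm_nonneg _) (hwt.one_le _)
  have hsW' : ∀ W, Summable fun n => a n W := fun W => (hsW'' W).of_norm
  -- the bi-graded pinned row sums of the terms
  set f₂ : ℝ := (Real.exp 2 * (κ + ρ)) ^ (2 * 2) * N 2 with hf₂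
  set t : ℝ := Real.exp 1 * α / κ ^ 2 with ht
  have hf₂0 : 0 ≤ f₂ := by rw [hf₂]; exact mul_nonneg (by positivity) (hN0 2)
  have ht0 : 0 < t := by rw [ht]; positivity
  have hθt : θ = t * nV := by rw [hθdef, ht]; ring
  set k : ℕ := p - 1 with hk
  have hk1 : 1 ≤ k := by omega
  set R : ℕ → ℝ := fun n => ρ⁻¹ ^ (2 * p) * (κ ^ 2 / α) * f₂ ^ k * (((n.choose k : ℕ) : ℝ) * t ^ n * nV ^ (n - k)) with hR
  have hR0 : ∀ n, 0 ≤ R n := fun n => by rw [hR]; positivity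
  -- the constant of the order-`n` bound in the form `ρ^{-m} (κ²/α) tⁿ`
  have hconst : ∀ {n : ℕ}, 0 < n →
      ρ⁻¹ ^ (2 * p) * κ⁻¹ ^ (2 * (n - 1)) * (α ^ (n - 1) * Real.exp n) = ρ⁻¹ ^ (2 * p) * (κ ^ 2 / α) * t ^ n := by
    intro n hn
    obtain ⟨n', rfl⟩ : ∃ n', n = n' + 1 := ⟨n - 1, by omega⟩
    rw [ht, hexpn, Nat.add_sub_cancel, div_pow, inv_pow, inv_pow]
    have hκne : κ ≠ 0 := hκ.ne'
    have hαne : α ≠ 0 := hα.ne'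
    field_simp
    ring
  have hrowR : ∀ n, ∑ W ∈ univ.filter (fun W : Fin (2 * p) → Γ => W i = w), wt (univ.image W) * ‖a n W‖ ≤ R n := by
    intro n
    rcases Nat.eq_zero_or_pos n with rfl | hn
    · have h0 : ∀ W, wt (univ.image W) * ‖a 0 W‖ = 0 := fun W => by rw [hanorm]; simp
      simp only [h0, sum_const_zero]
      exact hR0 0
    simp only [hanorm, if_neg hn.ne']
    rw [← mul_sum]
    have h := sum_wt_norm_kernel_cumulantOf_le_biquartic_of_gramBounded C hwt hκ hGB degs K N hN0 hNw hN2 hα hrow hcol hρ hn i w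
    rw [← hκs_eq, hnVsum, hconst hn] at h
    calc (n ! : ℝ)⁻¹ * ∑ W ∈ univ.filter (fun W : Fin (2 * p) → Γ => W i = w),
            wt (univ.image W) * ‖kernel 𝕜 ((κs n : evenPart 𝕜 Γ) : GrassmannAlgebra 𝕜 Γ) (2 * p) W‖
        ≤ (n ! : ℝ)⁻¹ * ((n ! : ℝ) * R n) := by
          refine mul_le_mul_of_nonneg_left (h.trans (le_of_eq ?_)) (by positivity)
          rw [hR, ← hf₂, ← hk]
          ring
      _ = R n := by field_simp
  -- the series `Σ_n C(n,k) tⁿ nV^{n-k} = t^k (1-θ)^{-(k+1)}`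
  have hθnorm : ‖θ‖ < 1 := by rw [Real.norm_eq_abs, abs_of_nonneg hθ0]; exact hθ1
  have hser0 := hasSum_choose_mul_geometric_of_norm_lt_one k hθnorm
  have hserR : HasSum R (ρ⁻¹ ^ (2 * p) * (κ ^ 2 / α) * f₂ ^ k * (t ^ k * (1 / (1 - θ) ^ (k + 1)))) := by
    have h1 : HasSum (fun j => R (j + k)) (ρ⁻¹ ^ (2 * p) * (κ ^ 2 / α) * f₂ ^ k * (t ^ k * (1 / (1 - θ) ^ (k + 1)))) := by
      have h2 := (hser0.mul_left (t ^ k)).mul_left (ρ⁻¹ ^ (2 * p) * (κ ^ 2 / α) * f₂ ^ k)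
      refine h2.congr_fun fun j => ?_
      rw [hR]
      dsimp only
      rw [Nat.add_sub_cancel, hθt, mul_pow, pow_add]
      ring
    have h3 := (hasSum_nat_add_iff (f := R) k).1 h1
    have hzero : ∑ i ∈ range k, R i = 0 := by
      refine sum_eq_zero fun i hi => ?_
      rw [hR]
      dsimp only
      rw [Nat.choose_eq_zero_of_lt (mem_range.1 hi), Nat.cast_zero, zero_mul, zero_mul, mul_zero]
    rwa [hzero, add_zero] at h3
  have hsR : Summable R := hserR.summable
  -- assemble
  have hk' : ∀ W, kernel 𝕜 (effAction 𝕜 C V) (2 * p) W = -∑' n, a n W := fun W => hker hm W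
  calc ∑ W ∈ univ.filter (fun W : Fin (2 * p) → Γ => W i = w), wt (univ.image W) * ‖kernel 𝕜 (effAction 𝕜 C V) (2 * p) W‖
      = ∑ W ∈ univ.filter (fun W : Fin (2 * p) → Γ => W i = w), wt (univ.image W) * ‖∑' n, a n W‖ :=
        sum_congr rfl fun W _ => by rw [hk' W, norm_neg]
    _ ≤ ∑ W ∈ univ.filter (fun W : Fin (2 * p) → Γ => W i = w), ∑' n, wt (univ.image W) * ‖a n W‖ := by
        refine sum_le_sum fun W _ => ?_
        rw [tsum_mul_left]
        exact mul_le_mul_of_nonneg_left (norm_tsum_le_tsum_norm (hsW'' W)) (hwt.nonneg _)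
    _ = ∑' n, ∑ W ∈ univ.filter (fun W : Fin (2 * p) → Γ => W i = w), wt (univ.image W) * ‖a n W‖ :=
        (Summable.tsum_finsetSum fun W _ => hsW W).symm
    _ ≤ ∑' n, R n := Summable.tsum_le_tsum hrowR (summable_sum fun W _ => hsW W) hsR
    _ = ρ⁻¹ ^ (2 * p) * (κ ^ 2 / α) * f₂ ^ k * (t ^ k * (1 / (1 - θ) ^ (k + 1))) := hserR.tsum_eq
    _ = ρ⁻¹ ^ (2 * p) * (Real.exp 1 * f₂) * (Real.exp 1 * α * f₂ / κ ^ 2) ^ (p - 2) / (1 - θ) ^ p := by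
        obtain ⟨p', rfl⟩ : ∃ p', p = p' + 2 := ⟨p - 2, by omega⟩
        have hkp : k = p' + 1 := by omega
        rw [hkp, ht, show p' + 2 - 2 = p' from rfl, show p' + 1 + 1 = p' + 2 from rfl]
        have hκ2 : κ ^ 2 ≠ 0 := by positivity
        have hαne : α ≠ 0 := hα.ne'
        have h1θ : (1 - θ) ≠ 0 := by linarith
        have hκne : κ ≠ 0 := hκ.ne'
        simp only [inv_pow, div_pow, mul_pow, one_div]
        field_simp
        ring

end Literature.MathematicalPhysics.QuantumLattice

end
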